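import Mathlib
import Summits.NavierStokesRegularity.FluidComputer.SkewCutGalerkinReality
import Summits.NavierStokesRegularity.FluidComputer.SkewCutGalerkinFromResolventData

/-!
# Skew-cut X0 certificate: the REAL door — the certifiers' real matrix tests give the
# complex-quantified matrix data of the END-TO-END theorem ((F4) reality, matrix form)
(instab3 g6 — implementation 1 of the skew-cut X0 certifier, cell `ns-blowup`, 2026-08-27)

HONEST FRAMING (human rulings D-0035/D-0074): nothing here is a claim about Navier–Stokes
blow-up. WHAT THIS IS NOT: not NS evidence. MODEL-lane bookkeeping about the FORMAT of the
GROUP-A X0 certificates; no certificate, printed number or census word is moved.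

`SkewCutGalerkinFromResolventData.exists_smooth_eigenvector_Ioo_of_sections_of_resolvent_data`
(profile-cert-3 g6) is the END-TO-END statement of the X0 chain FROM MATRIX DATA: at each bracket
end `z ∈ {a, e}` it asks for a left inverse `Binv` of the Galerkin matrix `z·1 − L_K`, three bounds
`α, β_B, β_C`, the TAIL CONSTANT, and the SHELL inequality

  `MU2 Σ_{i∈sh} |e_i|² ≤ Σ_{i∈sh} (z − ℓ_i − s)|e_i|² − Re Σ_i conj((C Binv B e)_i) e_i`

for ALL COMPLEX coefficient vectors `e` vanishing on the head `K` (`B`, `C` the off-head blocks of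
the first-order matrix `a_ij = t_ij (x₀ − ℓ_j)`). What the two certifiers PRINT is the REAL test
«`λ_min(Λ_{K+1} − s + Q_K) ≥ MU2`, `Q_K = −½(C_K N_K B_K + (C_K N_K B_K)ᵀ)`» for their REAL
matrices in a J-real class basis (INSTAB3-METHOD §5 (V5), METHOD-I4 §3; SKEWCUT-CERT remark (F4)).
This file is the adapter: when the first-order matrix and the left inverse are REAL
(`a_ij = ar_ij ∈ ℝ`, `Binv` = complexification of a real matrix `Br`),

* `shellM_of_real_form`: the real quadratic-form test (on real vectors vanishing on `K`) implies
  the complex shell inequality `hshellM` (real and imaginary parts separately —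
  `SkewCutGalerkinReality.complex_form_ge_of_real_form` is the same remark for an abstract `q`);
* `binv_of_real`, `alphaM_of_real`, `betaBM_of_real`, `betaCM_of_real`: the left-inverse identity
  and the three bounds lift from real vectors to complex vectors;
* `exists_smooth_eigenvector_Ioo_of_sections_of_real_resolvent_data`: the END-TO-END statement with
  the Theorem-R data at both ends given by REAL matrices and REAL tests — literally the shape the
  certifiers verify (left inverse of `z·1 − L_K`, bounds, `λ_min(Λ_{K+1} − s − sym(C N B)) ≥ MU2`
  as a real quadratic-form inequality, tail constant), conclusion verbatim.

What stays model-specific: that the class-II first-order matrix IS real in the certifiers' J-real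
bases (INSTAB3-METHOD §4: «imaginary balls all contain 0»; Craya side `CrayaReality`), the section
pairing bound `s = √2`, and the transcribed numbers (CERTIFIER AUDIT). Mathlib + `SkewCutGalerkinReality`
+ `SkewCutGalerkinFromResolventData`; no definitions. [folklore] throughout.
-/

noncomputable section
namespace Summit.NavierStokesRegularity.FluidComputer.SkewCutGalerkinRealShell

open Filter Topology Submodule
open scoped BigOperators InnerProductSpace ComplexConjugate
variable {𝕜 : Type*} [RCLike 𝕜] {ι : Type*}

/-! ### Real and imaginary parts of real-coefficient combinations -/
/-- `Re Σ_{a∈S} r_a z_a = Σ_{a∈S} r_a Re z_a` for real coefficients `r`. -/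
theorem re_sum_ofReal_mul {α : Type*} (S : Finset α) (r : α → ℝ) (z : α → 𝕜) :
    RCLike.re (∑ a ∈ S, (r a : 𝕜) * z a) = ∑ a ∈ S, r a * RCLike.re (z a) := by
  rw [map_sum]
  exact Finset.sum_congr rfl fun a _ => RCLike.re_ofReal_mul _ _

/-- `Im Σ_{a∈S} r_a z_a = Σ_{a∈S} r_a Im z_a` for real coefficients `r`. -/
theorem im_sum_ofReal_mul {α : Type*} (S : Finset α) (r : α → ℝ) (z : α → 𝕜) :
    RCLike.im (∑ a ∈ S, (r a : 𝕜) * z a) = ∑ a ∈ S, r a * RCLike.im (z a) := by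
  rw [map_sum]
  exact Finset.sum_congr rfl fun a _ => RCLike.im_ofReal_mul _ _

/-- `Re (conj w · z) = Re w Re z + Im w Im z`. -/
theorem re_conj_mul (w z : 𝕜) :
    RCLike.re (conj w * z) = RCLike.re w * RCLike.re z + RCLike.im w * RCLike.im z := by
  rw [RCLike.mul_re, RCLike.conj_re, RCLike.conj_im]; ring


/-- The coupling `B e` of a tail vector into the head has real and imaginary parts given by the real
matrix on the real and imaginary parts. -/
theorem re_im_B [DecidableEq ι] (K : Finset ι) (nbr : ι → Finset ι) (t : ι → ι → 𝕜) (x₀ : ℝ)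
    (ℓ : ι → ℝ) (ar : ι → ι → ℝ) (har : ∀ i j, t i j * ((x₀ : 𝕜) - (ℓ j : 𝕜)) = (ar i j : 𝕜))
    (e : ι → 𝕜) (m : ι) :
    RCLike.re (∑ l ∈ nbr m \ K, (t m l * ((x₀ : 𝕜) - (ℓ l : 𝕜))) * e l) =
        ∑ l ∈ nbr m \ K, ar m l * RCLike.re (e l) ∧
      RCLike.im (∑ l ∈ nbr m \ K, (t m l * ((x₀ : 𝕜) - (ℓ l : 𝕜))) * e l) =
        ∑ l ∈ nbr m \ K, ar m l * RCLike.im (e l) := by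
  simp only [har]
  exact ⟨re_sum_ofReal_mul _ _ _, im_sum_ofReal_mul _ _ _⟩

/-- Real and imaginary parts of `Binv c` for the complexified real matrix. -/
theorem re_im_Binv (K : Finset ι) (Binv : (K → 𝕜) →ₗ[𝕜] (K → 𝕜)) (Br : K → K → ℝ)
    (hBr : ∀ (c : K → 𝕜) (j : K), Binv c j = ∑ m : K, (Br j m : 𝕜) * c m)
    (c : K → 𝕜) (j : K) :
    RCLike.re (Binv c j) = ∑ m : K, Br j m * RCLike.re (c m) ∧
      RCLike.im (Binv c j) = ∑ m : K, Br j m * RCLike.im (c m) := by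
  rw [hBr]
  exact ⟨re_sum_ofReal_mul _ _ _, im_sum_ofReal_mul _ _ _⟩

/-- Real and imaginary parts of the CROSS vector `C Binv B e`. -/
theorem re_im_cross [DecidableEq ι] (K : Finset ι) (nbr : ι → Finset ι) (t : ι → ι → 𝕜) (x₀ : ℝ)
    (ℓ : ι → ℝ) (ar : ι → ι → ℝ) (har : ∀ i j, t i j * ((x₀ : 𝕜) - (ℓ j : 𝕜)) = (ar i j : 𝕜))
    (Binv : (K → 𝕜) →ₗ[𝕜] (K → 𝕜)) (Br : K → K → ℝ)
    (hBr : ∀ (c : K → 𝕜) (j : K), Binv c j = ∑ m : K, (Br j m : 𝕜) * c m)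
    (e : ι → 𝕜) (i : ι) :
    RCLike.re (∑ j : K, (t i j * ((x₀ : 𝕜) - (ℓ j : 𝕜))) *
        Binv (fun i : K => ∑ j ∈ nbr i \ K, (t i j * ((x₀ : 𝕜) - (ℓ j : 𝕜))) * e j) j) =
      ∑ j : K, ar i j * ∑ m : K, Br j m * ∑ l ∈ nbr m \ K, ar m l * RCLike.re (e l) ∧
    RCLike.im (∑ j : K, (t i j * ((x₀ : 𝕜) - (ℓ j : 𝕜))) *
        Binv (fun i : K => ∑ j ∈ nbr i \ K, (t i j * ((x₀ : 𝕜) - (ℓ j : 𝕜))) * e j) j) =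
      ∑ j : K, ar i j * ∑ m : K, Br j m * ∑ l ∈ nbr m \ K, ar m l * RCLike.im (e l) := by
  have hB := fun m => re_im_B K nbr t x₀ ℓ ar har e m
  have hN := re_im_Binv K Binv Br hBr
    (fun i : K => ∑ j ∈ nbr i \ K, (t i j * ((x₀ : 𝕜) - (ℓ j : 𝕜))) * e j)
  constructor
  · rw [show (∑ j : K, (t i j * ((x₀ : 𝕜) - (ℓ j : 𝕜))) *
        Binv (fun i : K => ∑ j ∈ nbr i \ K, (t i j * ((x₀ : 𝕜) - (ℓ j : 𝕜))) * e j) j) =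
        ∑ j : K, (ar i j : 𝕜) *
          Binv (fun i : K => ∑ j ∈ nbr i \ K, (t i j * ((x₀ : 𝕜) - (ℓ j : 𝕜))) * e j) j from
        Finset.sum_congr rfl fun j _ => by rw [har], re_sum_ofReal_mul]
    refine Finset.sum_congr rfl fun j _ => ?_
    rw [(hN j).1]
    congr 1
    exact Finset.sum_congr rfl fun m _ => by rw [(hB m).1]
  · rw [show (∑ j : K, (t i j * ((x₀ : 𝕜) - (ℓ j : 𝕜))) *
        Binv (fun i : K => ∑ j ∈ nbr i \ K, (t i j * ((x₀ : 𝕜) - (ℓ j : 𝕜))) * e j) j) =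
        ∑ j : K, (ar i j : 𝕜) *
          Binv (fun i : K => ∑ j ∈ nbr i \ K, (t i j * ((x₀ : 𝕜) - (ℓ j : 𝕜))) * e j) j from
        Finset.sum_congr rfl fun j _ => by rw [har], im_sum_ofReal_mul]
    refine Finset.sum_congr rfl fun j _ => ?_
    rw [(hN j).2]
    congr 1
    exact Finset.sum_congr rfl fun m _ => by rw [(hB m).2]

/-- **The REAL door to the shell hypothesis.** If the first-order matrix is real (`a_ij = ar_ij`) and
`Binv` is the complexification of a real matrix `Br`, the certifiers' REAL test
`MU2 Σ_{i∈sh} x_i² ≤ Σ_{i∈sh} (a − ℓ_i − s) x_i² − xᵀ (C Br B) x` for all REAL `x` vanishing on the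
head `K` (i.e. `λ_min(Λ_{K+1} − s − sym(C_K N_K B_K)) ≥ MU2`, the (V5) test) implies the
complex-quantified shell inequality `hshellM` of `SkewCutGalerkinFromResolventData`. -/
theorem shellM_of_real_form [DecidableEq ι] (K : Finset ι) (nbr : ι → Finset ι) (t : ι → ι → 𝕜) (x₀ : ℝ)
    (ℓ : ι → ℝ) (ar : ι → ι → ℝ) (har : ∀ i j, t i j * ((x₀ : 𝕜) - (ℓ j : 𝕜)) = (ar i j : 𝕜))
    (Binv : (K → 𝕜) →ₗ[𝕜] (K → 𝕜)) (Br : K → K → ℝ)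
    (hBr : ∀ (c : K → 𝕜) (j : K), Binv c j = ∑ m : K, (Br j m : 𝕜) * c m)
    (a s MU2 : ℝ) (sh : Finset ι)
    (hreal : ∀ x : ι → ℝ, (∀ i ∈ K, x i = 0) →
      MU2 * ∑ i ∈ sh, x i ^ 2 ≤ ∑ i ∈ sh, (a - ℓ i - s) * x i ^ 2 -
        ∑ i ∈ K.biUnion nbr \ K,
          (∑ j : K, ar i j * ∑ m : K, Br j m * ∑ l ∈ nbr m \ K, ar m l * x l) * x i) :
    ∀ e : ι → 𝕜, (∀ i ∈ K, e i = 0) →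
      MU2 * ∑ i ∈ sh, ‖e i‖ ^ 2 ≤ ∑ i ∈ sh, (a - ℓ i - s) * ‖e i‖ ^ 2 -
        RCLike.re (∑ i ∈ K.biUnion nbr \ K,
          conj (∑ j : K, (t i j * ((x₀ : 𝕜) - (ℓ j : 𝕜))) *
            Binv (fun i : K => ∑ j ∈ nbr i \ K, (t i j * ((x₀ : 𝕜) - (ℓ j : 𝕜))) * e j) j) *
          e i) := by
  intro e he
  have hx := hreal (fun i => RCLike.re (e i)) fun i hi => by simp [he i hi]
  have hy := hreal (fun i => RCLike.im (e i)) fun i hi => by simp [he i hi]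
  have hcross := fun i => re_im_cross K nbr t x₀ ℓ ar har Binv Br hBr e i
  rw [map_sum]
  simp only [re_conj_mul, SkewCutGalerkinReality.norm_sq_eq_re_sq_add_im_sq]
  have e1 : ∑ i ∈ sh, (RCLike.re (e i) ^ 2 + RCLike.im (e i) ^ 2) =
      ∑ i ∈ sh, RCLike.re (e i) ^ 2 + ∑ i ∈ sh, RCLike.im (e i) ^ 2 := Finset.sum_add_distrib
  have e2 : ∑ i ∈ sh, (a - ℓ i - s) * (RCLike.re (e i) ^ 2 + RCLike.im (e i) ^ 2) =
      ∑ i ∈ sh, (a - ℓ i - s) * RCLike.re (e i) ^ 2 +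
        ∑ i ∈ sh, (a - ℓ i - s) * RCLike.im (e i) ^ 2 := by
    rw [← Finset.sum_add_distrib]; exact Finset.sum_congr rfl fun i _ => by ring
  have e3 : ∑ i ∈ K.biUnion nbr \ K,
      (RCLike.re (∑ j : K, (t i j * ((x₀ : 𝕜) - (ℓ j : 𝕜))) *
          Binv (fun i : K => ∑ j ∈ nbr i \ K, (t i j * ((x₀ : 𝕜) - (ℓ j : 𝕜))) * e j) j) *
          RCLike.re (e i) +
        RCLike.im (∑ j : K, (t i j * ((x₀ : 𝕜) - (ℓ j : 𝕜))) *
          Binv (fun i : K => ∑ j ∈ nbr i \ K, (t i j * ((x₀ : 𝕜) - (ℓ j : 𝕜))) * e j) j) *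
          RCLike.im (e i)) =
      ∑ i ∈ K.biUnion nbr \ K,
          (∑ j : K, ar i j * ∑ m : K, Br j m * ∑ l ∈ nbr m \ K, ar m l * RCLike.re (e l)) *
            RCLike.re (e i) +
        ∑ i ∈ K.biUnion nbr \ K,
          (∑ j : K, ar i j * ∑ m : K, Br j m * ∑ l ∈ nbr m \ K, ar m l * RCLike.im (e l)) *
            RCLike.im (e i) := by
    rw [← Finset.sum_add_distrib]
    exact Finset.sum_congr rfl fun i _ => by rw [(hcross i).1, (hcross i).2]
  rw [e1, e2, e3]
  linarith

/-- **Left-inverse identity from the real one.** If `Br` is a left inverse of the REAL Galerkin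
matrix `a·1 − L_K = [(a − ℓ_j) δ_ij − ar_ij]_K` on real vectors, its complexification `Binv` is a
left inverse of `a·1 − L_K` on complex vectors (the `hBinv` datum at a real end `a`). -/
theorem binv_of_real (K : Finset ι) (t : ι → ι → 𝕜) (x₀ : ℝ) (ℓ : ι → ℝ)
    (ar : ι → ι → ℝ) (har : ∀ i j, t i j * ((x₀ : 𝕜) - (ℓ j : 𝕜)) = (ar i j : 𝕜))
    (Binv : (K → 𝕜) →ₗ[𝕜] (K → 𝕜)) (Br : K → K → ℝ)
    (hBr : ∀ (c : K → 𝕜) (j : K), Binv c j = ∑ m : K, (Br j m : 𝕜) * c m)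
    (a : ℝ)
    (hreal : ∀ (v : K → ℝ) (j : K),
      ∑ m : K, Br j m * ((a - ℓ m) * v m - ∑ l : K, ar m l * v l) = v j) :
    ∀ c : K → 𝕜, Binv (fun i : K => (((a : ℝ) : 𝕜) - (ℓ i : 𝕜)) * c i -
      ∑ j : K, (t i j * ((x₀ : 𝕜) - (ℓ j : 𝕜))) * c j) = c := by
  intro c
  funext j
  have hN := re_im_Binv K Binv Br hBr
    (fun i : K => (((a : ℝ) : 𝕜) - (ℓ i : 𝕜)) * c i -
      ∑ j : K, (t i j * ((x₀ : 𝕜) - (ℓ j : 𝕜))) * c j) j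
  have hin : ∀ m : K, ((((a : ℝ) : 𝕜) - (ℓ m : 𝕜)) * c m -
      ∑ l : K, (t m l * ((x₀ : 𝕜) - (ℓ l : 𝕜))) * c l) =
      ((a - ℓ m : ℝ) : 𝕜) * c m - ∑ l : K, (ar m l : 𝕜) * c l := fun m => by
    rw [Finset.sum_congr rfl fun l _ => by rw [har]]
    push_cast; ring
  refine RCLike.ext ?_ ?_
  · rw [hN.1, ← hreal (fun m => RCLike.re (c m)) j]
    refine Finset.sum_congr rfl fun m _ => ?_
    rw [hin m, map_sub, RCLike.re_ofReal_mul, re_sum_ofReal_mul]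
  · rw [hN.2, ← hreal (fun m => RCLike.im (c m)) j]
    refine Finset.sum_congr rfl fun m _ => ?_
    rw [hin m, map_sub, RCLike.im_ofReal_mul, im_sum_ofReal_mul]

/-- **`α` bound from the real one**: `Σ_j |(Binv c)_j|² ≤ α² Σ_i |c_i|²` for complex `c` if it holds
for real vectors. -/
theorem alphaM_of_real (K : Finset ι) (Binv : (K → 𝕜) →ₗ[𝕜] (K → 𝕜)) (Br : K → K → ℝ)
    (hBr : ∀ (c : K → 𝕜) (j : K), Binv c j = ∑ m : K, (Br j m : 𝕜) * c m)
    (α : ℝ)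
    (hreal : ∀ v : K → ℝ, ∑ j : K, (∑ m : K, Br j m * v m) ^ 2 ≤ α ^ 2 * ∑ i : K, v i ^ 2) :
    ∀ c : K → 𝕜, ∑ j : K, ‖Binv c j‖ ^ 2 ≤ α ^ 2 * ∑ i : K, ‖c i‖ ^ 2 := by
  intro c
  have hx := hreal fun m => RCLike.re (c m)
  have hy := hreal fun m => RCLike.im (c m)
  have hN := fun j => re_im_Binv K Binv Br hBr c j
  simp only [SkewCutGalerkinReality.norm_sq_eq_re_sq_add_im_sq]
  rw [Finset.sum_add_distrib, Finset.sum_add_distrib, mul_add]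
  have e1 : ∑ j : K, RCLike.re (Binv c j) ^ 2 = ∑ j : K, (∑ m : K, Br j m * RCLike.re (c m)) ^ 2 :=
    Finset.sum_congr rfl fun j _ => by rw [(hN j).1]
  have e2 : ∑ j : K, RCLike.im (Binv c j) ^ 2 = ∑ j : K, (∑ m : K, Br j m * RCLike.im (c m)) ^ 2 :=
    Finset.sum_congr rfl fun j _ => by rw [(hN j).2]
  rw [e1, e2]
  exact add_le_add hx hy

/-- **`β_B` bound from the real one**: `‖Binv B e‖ ≤ β_B ‖e|_{shell}‖` for complex `e` if it holds for
real vectors. -/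
theorem betaBM_of_real [DecidableEq ι] (K : Finset ι) (nbr : ι → Finset ι) (t : ι → ι → 𝕜) (x₀ : ℝ)
    (ℓ : ι → ℝ) (ar : ι → ι → ℝ) (har : ∀ i j, t i j * ((x₀ : 𝕜) - (ℓ j : 𝕜)) = (ar i j : 𝕜))
    (Binv : (K → 𝕜) →ₗ[𝕜] (K → 𝕜)) (Br : K → K → ℝ)
    (hBr : ∀ (c : K → 𝕜) (j : K), Binv c j = ∑ m : K, (Br j m : 𝕜) * c m)
    (βB : ℝ)
    (hreal : ∀ x : ι → ℝ, ∑ j : K, (∑ m : K, Br j m * -∑ l ∈ nbr m \ K, ar m l * x l) ^ 2 ≤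
      βB ^ 2 * ∑ j ∈ K.biUnion nbr \ K, x j ^ 2) :
    ∀ e : ι → 𝕜, ∑ j : K, ‖Binv (fun i : K => -∑ j ∈ nbr i \ K,
        (t i j * ((x₀ : 𝕜) - (ℓ j : 𝕜))) * e j) j‖ ^ 2 ≤
        βB ^ 2 * ∑ j ∈ K.biUnion nbr \ K, ‖e j‖ ^ 2 := by
  intro e
  have hx := hreal fun l => RCLike.re (e l)
  have hy := hreal fun l => RCLike.im (e l)
  have hB := fun m => re_im_B K nbr t x₀ ℓ ar har e m
  have hN := fun j => re_im_Binv K Binv Br hBr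
    (fun i : K => -∑ j ∈ nbr i \ K, (t i j * ((x₀ : 𝕜) - (ℓ j : 𝕜))) * e j) j
  simp only [SkewCutGalerkinReality.norm_sq_eq_re_sq_add_im_sq]
  rw [Finset.sum_add_distrib, Finset.sum_add_distrib, mul_add]
  have e1 : ∑ j : K, RCLike.re (Binv (fun i : K => -∑ j ∈ nbr i \ K,
        (t i j * ((x₀ : 𝕜) - (ℓ j : 𝕜))) * e j) j) ^ 2 =
      ∑ j : K, (∑ m : K, Br j m * -∑ l ∈ nbr m \ K, ar m l * RCLike.re (e l)) ^ 2 := by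
    refine Finset.sum_congr rfl fun j _ => ?_
    rw [(hN j).1]
    congr 1
    exact Finset.sum_congr rfl fun m _ => by rw [map_neg, (hB m).1]
  have e2 : ∑ j : K, RCLike.im (Binv (fun i : K => -∑ j ∈ nbr i \ K,
        (t i j * ((x₀ : 𝕜) - (ℓ j : 𝕜))) * e j) j) ^ 2 =
      ∑ j : K, (∑ m : K, Br j m * -∑ l ∈ nbr m \ K, ar m l * RCLike.im (e l)) ^ 2 := by
    refine Finset.sum_congr rfl fun j _ => ?_
    rw [(hN j).2]
    congr 1
    exact Finset.sum_congr rfl fun m _ => by rw [map_neg, (hB m).2]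
  rw [e1, e2]
  exact add_le_add hx hy

/-- **`β_C` bound from the real one**: `‖C Binv c‖ ≤ β_C ‖c‖` for complex `c` if it holds for real
vectors. -/
theorem betaCM_of_real [DecidableEq ι] (K : Finset ι) (nbr : ι → Finset ι) (t : ι → ι → 𝕜) (x₀ : ℝ)
    (ℓ : ι → ℝ) (ar : ι → ι → ℝ) (har : ∀ i j, t i j * ((x₀ : 𝕜) - (ℓ j : 𝕜)) = (ar i j : 𝕜))
    (Binv : (K → 𝕜) →ₗ[𝕜] (K → 𝕜)) (Br : K → K → ℝ)
    (hBr : ∀ (c : K → 𝕜) (j : K), Binv c j = ∑ m : K, (Br j m : 𝕜) * c m)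
    (βC : ℝ)
    (hreal : ∀ v : K → ℝ, ∑ i ∈ K.biUnion nbr \ K, (∑ j : K, ar i j * ∑ m : K, Br j m * v m) ^ 2 ≤
      βC ^ 2 * ∑ i : K, v i ^ 2) :
    ∀ c : K → 𝕜, ∑ i ∈ K.biUnion nbr \ K,
      ‖∑ j : K, (t i j * ((x₀ : 𝕜) - (ℓ j : 𝕜))) * Binv c j‖ ^ 2 ≤ βC ^ 2 * ∑ i : K, ‖c i‖ ^ 2 := by
  intro c
  have hx := hreal fun m => RCLike.re (c m)
  have hy := hreal fun m => RCLike.im (c m)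
  have hN := fun j => re_im_Binv K Binv Br hBr c j
  have hC : ∀ i, (∑ j : K, (t i j * ((x₀ : 𝕜) - (ℓ j : 𝕜))) * Binv c j) =
      ∑ j : K, (ar i j : 𝕜) * Binv c j := fun i => Finset.sum_congr rfl fun j _ => by rw [har]
  simp only [SkewCutGalerkinReality.norm_sq_eq_re_sq_add_im_sq, hC, re_sum_ofReal_mul, im_sum_ofReal_mul]
  rw [Finset.sum_add_distrib, Finset.sum_add_distrib, mul_add]
  have e1 : ∑ i ∈ K.biUnion nbr \ K, (∑ j : K, ar i j * RCLike.re (Binv c j)) ^ 2 =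
      ∑ i ∈ K.biUnion nbr \ K, (∑ j : K, ar i j * ∑ m : K, Br j m * RCLike.re (c m)) ^ 2 := by
    refine Finset.sum_congr rfl fun i _ => ?_
    congr 1
    exact Finset.sum_congr rfl fun j _ => by rw [(hN j).1]
  have e2 : ∑ i ∈ K.biUnion nbr \ K, (∑ j : K, ar i j * RCLike.im (Binv c j)) ^ 2 =
      ∑ i ∈ K.biUnion nbr \ K, (∑ j : K, ar i j * ∑ m : K, Br j m * RCLike.im (c m)) ^ 2 := by
    refine Finset.sum_congr rfl fun i _ => ?_
    congr 1
    exact Finset.sum_congr rfl fun j _ => by rw [(hN j).2]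
  rw [e1, e2]
  exact add_le_add hx hy


/-! ### The END-TO-END statement with REAL Theorem-R data at both ends -/

/-- **SKEW-CUT X0 CERTIFICATE END-TO-END FROM REAL MATRIX DATA.**
`SkewCutGalerkinFromResolventData.exists_smooth_eigenvector_Ioo_of_sections_of_resolvent_data` with
the Theorem-R data at the two real ends `a`, `e` supplied by REAL matrices and REAL tests — the
shape the two certifiers verify: a real first-order matrix `ar` (`t_ij (x₀ − ℓ_j) = ar_ij`), a real
left inverse `Br` of the real Galerkin matrix `[(z − ℓ_j) δ_ij − ar_ij]_K` (`z = a, e`), the three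
bounds `α, β_B, β_C` on real vectors, the REAL shell test
`MU2 |x|² ≤ xᵀ(Λ_{K+1} − s)x − xᵀ(C Br B)x` on real vectors vanishing on the head
(`λ_min(Λ_{K+1} − s − sym(C_K N_K B_K)) ≥ MU2`, the (V5) test), and the tail constant; conclusion
verbatim (a bounded `T` with matrix `t`, an eigenvalue `λ ∈ (a, e)` with a unit `H^∞` eigenvector).
MODEL-lane format theorem; no number is moved. -/
theorem exists_smooth_eigenvector_Ioo_of_sections_of_real_resolvent_data
    {H : Type*} [NormedAddCommGroup H] [InnerProductSpace 𝕜 H] [CompleteSpace H]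
    [DecidableEq ι] (b : HilbertBasis ι 𝕜 H)
    (ℓ : ι → ℝ) (x₀ : ℝ) (d : lp (fun _ : ι => 𝕜) ⊤) (hd : ∀ i, d i * ((x₀ : 𝕜) - (ℓ i : 𝕜)) = 1)
    (hd0 : Tendsto (fun i => ‖d i‖) cofinite (𝓝 0))
    (t : ι → ι → 𝕜) {R₀ C₀ : ℝ} (hrow : ∀ i, Summable fun j => ‖t i j‖)
    (hR : ∀ i, ∑' j, ‖t i j‖ ≤ R₀) (hcol : ∀ j, Summable fun i => ‖t i j‖)
    (hC₀ : ∀ j, ∑' i, ‖t i j‖ ≤ C₀) (hR0 : 0 ≤ R₀) (hC0 : 0 ≤ C₀) (hq : R₀ * C₀ < 1)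
    (nbr : ι → Finset ι) (hsymm : ∀ i j, j ∈ nbr i ↔ i ∈ nbr j) {W : ℕ}
    (hW : ∀ i, (nbr i).card ≤ W) (ht0 : ∀ i j, j ∉ nbr i → t i j = 0)
    -- the first-order matrix `a_ij = t_ij (x₀ − ℓ_j)` is REAL
    (ar : ι → ι → ℝ) (har : ∀ i j, t i j * ((x₀ : 𝕜) - (ℓ j : 𝕜)) = (ar i j : 𝕜))
    (wgt : ι → ℝ) (hw0 : ∀ i, 0 ≤ wgt i) (hwℓ : ∀ i, wgt i ^ 2 ≤ 1 + |ℓ i|) {Kg : ℝ}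
    (hK : 0 ≤ Kg) (ha : ∀ i j, j ∈ nbr i → ‖t i j * ((x₀ : 𝕜) - (ℓ j : 𝕜))‖ ≤ Kg * wgt j)
    {L : ℝ} (hLnn : 0 ≤ L) (hL : ∀ i j, j ∈ nbr i → wgt i ≤ L * wgt j)
    {M : ℝ} (hM : ∀ i, ‖d i‖ * wgt i ≤ M)
    -- matrix eigenpairs of the finite sections
    (F : ℕ → Finset ι) (hF : Monotone F) (hFex : ∀ i, ∃ n, i ∈ F n)
    (c : ℕ → ι → 𝕜) (xs : ℕ → ℝ) {a e : ℝ} (hxs : ∀ n, xs n ∈ Set.Icc a e)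
    (heig : ∀ n, ∀ i ∈ F n, (ℓ i : 𝕜) * c n i +
      ∑ j ∈ F n, (t i j * ((x₀ : 𝕜) - (ℓ j : 𝕜))) * c n j = (xs n : 𝕜) * c n i)
    (hnorm : ∀ n, ∑ j ∈ F n, ‖c n j‖ ^ 2 = 1) {C : ℝ} (hCnn : 0 ≤ C)
    (hgraph : ∀ n, ∑ j ∈ F n, ‖((x₀ : 𝕜) - (ℓ j : 𝕜)) * c n j‖ ^ 2 ≤ C ^ 2)
    -- the section pairing hypothesis on the first-order matrix
    {s : ℝ}
    (hA : ∀ (G : Finset ι) (u : ι → 𝕜),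
      RCLike.re (∑ i ∈ G, ∑ j ∈ G, conj (u i) * (t i j * ((x₀ : 𝕜) - (ℓ j : 𝕜))) * u j) ≤
        s * ∑ i ∈ G, ‖u i‖ ^ 2)
    -- REAL Theorem-R data at the end `a`
    (Ka : Finset ι) (Bra : Ka → Ka → ℝ)
    (hBra : ∀ (v : Ka → ℝ) (j : Ka),
      ∑ m : Ka, Bra j m * ((a - ℓ m) * v m - ∑ l : Ka, ar m l * v l) = v j)
    {αa βBa βCa : ℝ} (hαa : 0 ≤ αa) (hβBa : 0 ≤ βBa) (hβCa : 0 ≤ βCa)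
    (hαMa : ∀ v : Ka → ℝ, ∑ j : Ka, (∑ m : Ka, Bra j m * v m) ^ 2 ≤ αa ^ 2 * ∑ i : Ka, v i ^ 2)
    (hβBMa : ∀ x : ι → ℝ, ∑ j : Ka, (∑ m : Ka, Bra j m * -∑ l ∈ nbr m \ Ka, ar m l * x l) ^ 2 ≤
      βBa ^ 2 * ∑ j ∈ Ka.biUnion nbr \ Ka, x j ^ 2)
    (hβCMa : ∀ v : Ka → ℝ, ∑ i ∈ Ka.biUnion nbr \ Ka,
      (∑ j : Ka, ar i j * ∑ m : Ka, Bra j m * v m) ^ 2 ≤ βCa ^ 2 * ∑ i : Ka, v i ^ 2)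
    {MU2a : ℝ} (hMU2a : 0 < MU2a) (sha : Finset ι)
    (hshella : ∀ x : ι → ℝ, (∀ i ∈ Ka, x i = 0) →
      MU2a * ∑ i ∈ sha, x i ^ 2 ≤ ∑ i ∈ sha, (a - ℓ i - s) * x i ^ 2 -
        ∑ i ∈ Ka.biUnion nbr \ Ka,
          (∑ j : Ka, ar i j * ∑ m : Ka, Bra j m * ∑ l ∈ nbr m \ Ka, ar m l * x l) * x i)
    (htaila : ∀ i, i ∉ Ka → i ∉ sha → MU2a ≤ a - ℓ i - s)
    -- REAL Theorem-R data at the end `e`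
    (Ke : Finset ι) (Bre : Ke → Ke → ℝ)
    (hBre : ∀ (v : Ke → ℝ) (j : Ke),
      ∑ m : Ke, Bre j m * ((e - ℓ m) * v m - ∑ l : Ke, ar m l * v l) = v j)
    {αe βBe βCe : ℝ} (hαe : 0 ≤ αe) (hβBe : 0 ≤ βBe) (hβCe : 0 ≤ βCe)
    (hαMe : ∀ v : Ke → ℝ, ∑ j : Ke, (∑ m : Ke, Bre j m * v m) ^ 2 ≤ αe ^ 2 * ∑ i : Ke, v i ^ 2)
    (hβBMe : ∀ x : ι → ℝ, ∑ j : Ke, (∑ m : Ke, Bre j m * -∑ l ∈ nbr m \ Ke, ar m l * x l) ^ 2 ≤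
      βBe ^ 2 * ∑ j ∈ Ke.biUnion nbr \ Ke, x j ^ 2)
    (hβCMe : ∀ v : Ke → ℝ, ∑ i ∈ Ke.biUnion nbr \ Ke,
      (∑ j : Ke, ar i j * ∑ m : Ke, Bre j m * v m) ^ 2 ≤ βCe ^ 2 * ∑ i : Ke, v i ^ 2)
    {MU2e : ℝ} (hMU2e : 0 < MU2e) (she : Finset ι)
    (hshelle : ∀ x : ι → ℝ, (∀ i ∈ Ke, x i = 0) →
      MU2e * ∑ i ∈ she, x i ^ 2 ≤ ∑ i ∈ she, (e - ℓ i - s) * x i ^ 2 -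
        ∑ i ∈ Ke.biUnion nbr \ Ke,
          (∑ j : Ke, ar i j * ∑ m : Ke, Bre j m * ∑ l ∈ nbr m \ Ke, ar m l * x l) * x i)
    (htaile : ∀ i, i ∉ Ke → i ∉ she → MU2e ≤ e - ℓ i - s) :
    ∃ T : H →L[𝕜] H, (∀ i j, ⟪b i, T (b j)⟫_𝕜 = t i j) ∧ ‖T‖ ≤ Real.sqrt (R₀ * C₀) ∧
      ∃ lam ∈ Set.Ioo a e, ∃ v : H, ‖v‖ = 1 ∧
        (∀ i, (ℓ i : 𝕜) * ⟪b i, v⟫_𝕜 +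
            ∑ j ∈ nbr i, (t i j * ((x₀ : 𝕜) - (ℓ j : 𝕜))) * ⟪b j, v⟫_𝕜 = (lam : 𝕜) * ⟪b i, v⟫_𝕜) ∧
        ∀ s : ℕ, Summable fun i => wgt i ^ (2 * s) * ‖⟪b i, v⟫_𝕜‖ ^ 2 := by
  let Binva : (Ka → 𝕜) →ₗ[𝕜] (Ka → 𝕜) := (Matrix.of fun j m : Ka => ((Bra j m : ℝ) : 𝕜)).mulVecLin
  have hBa : ∀ (c : Ka → 𝕜) (j : Ka), Binva c j = ∑ m : Ka, (Bra j m : 𝕜) * c m := fun c j => by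
    simp [Binva, Matrix.mulVec, dotProduct]
  let Binve : (Ke → 𝕜) →ₗ[𝕜] (Ke → 𝕜) := (Matrix.of fun j m : Ke => ((Bre j m : ℝ) : 𝕜)).mulVecLin
  have hBe : ∀ (c : Ke → 𝕜) (j : Ke), Binve c j = ∑ m : Ke, (Bre j m : 𝕜) * c m := fun c j => by
    simp [Binve, Matrix.mulVec, dotProduct]
  exact SkewCutGalerkinFromResolventData.exists_smooth_eigenvector_Ioo_of_sections_of_resolvent_data
    b ℓ x₀ d hd hd0 t hrow hR hcol hC₀ hR0 hC0 hq nbr hsymm hW ht0 wgt hw0 hwℓ hK ha hLnn hL hM F hF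
    hFex c xs hxs heig hnorm hCnn hgraph hA
    Ka Binva (binv_of_real Ka t x₀ ℓ ar har Binva Bra hBa a hBra) hαa hβBa hβCa
    (alphaM_of_real Ka Binva Bra hBa αa hαMa)
    (betaBM_of_real Ka nbr t x₀ ℓ ar har Binva Bra hBa βBa hβBMa)
    (betaCM_of_real Ka nbr t x₀ ℓ ar har Binva Bra hBa βCa hβCMa) hMU2a sha
    (shellM_of_real_form Ka nbr t x₀ ℓ ar har Binva Bra hBa a s MU2a sha hshella) htaila
    Ke Binve (binv_of_real Ke t x₀ ℓ ar har Binve Bre hBe e hBre) hαe hβBe hβCe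
    (alphaM_of_real Ke Binve Bre hBe αe hαMe)
    (betaBM_of_real Ke nbr t x₀ ℓ ar har Binve Bre hBe βBe hβBMe)
    (betaCM_of_real Ke nbr t x₀ ℓ ar har Binve Bre hBe βCe hβCMe) hMU2e she
    (shellM_of_real_form Ke nbr t x₀ ℓ ar har Binve Bre hBe e s MU2e she hshelle) htaile

end Summit.NavierStokesRegularity.FluidComputer.SkewCutGalerkinRealShell
end
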